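import Mathlib

/-!
# Cochain identities for the torsion-corner GMA point (solo-informed programme, Part II §7.10, Theorem Ω)

Theorem Ω of Part II §7.10 produces, in the "silent cell", a Cayley–Hamilton representation
`ρ = (ω α, b ; c, δ)` of the Galois group into a generalized matrix algebra over
`A = 𝔽_p[ε]/(ε^{p+1})` whose off-diagonal modules are `A/ε` (torsion corners) and whose corner
product is `ε^p t`.  Three pieces of pure algebra carry the argument and are recorded here,
over an arbitrary commutative ring and an arbitrary group `G`, with the cyclotomic character
replaced by a pair of mutually inverse monoid homomorphisms `ω, ω' : G →* A`:

* `soloInformed_torsionCorner_det_cochain` — for cocycles `b` (`b(gh) = ω(g) b(h) + b(g)`) and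
  `c` (`c(gh) = c(g) ω(h) + c(h)`), the function `ν(g) = ω'(g) b(g) c(g)` satisfies
  `ν(g) + ν(h) − ν(gh) = −(c(g) b(h) + ω'(gh) b(g) c(h))`; this is the identity that makes the
  fixed-determinant version of the (2,2)-entry equation follow from the (1,1)-entry equation.
* `soloInformed_torsionCorner_local_additive` — on a (decomposition) group where `c` is the
  coboundary `c(g) = β (ω(g) − 1)`, a cochain `x` with `x(gh) = x(g) + x(h) + t ω'(gh) b(g) c(h)`
  becomes additive after the correction `φ = x + t β ω' b`: the local flatness condition of
  Theorem Ω is a condition on the homomorphism `φ`.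
* `soloInformed_addMonoidHom_mul_eq_zero` / `soloInformed_symm_form_eq_zero` — an additive group
  is not the union of two proper subgroups: if `c(g) b(h) + b(g) c(h) = 0` for all `g, h`
  (with `2 ≠ 0` in a domain) then `b = 0` or `c = 0`; this is the step showing that the
  pseudocharacter of `ρ` is not a sum of two characters.
No arithmetic input.
-/

namespace Summit.Langlands.Langlands.Theorems

section cochains

variable {G : Type*} [Group G] {A : Type*} [CommRing A]

/-- The corner-product cochain `ν = ω' b c` has coboundary `−(κ + κ')`, where
`κ(g,h) = ω'(gh) b(g) c(h)` and `κ'(g,h) = c(g) b(h)` are the two corner cup products. -/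
theorem soloInformed_torsionCorner_det_cochain (ω ω' : G →* A)
    (hinv : ∀ g, ω g * ω' g = 1) (b c : G → A)
    (hb : ∀ g h, b (g * h) = ω g * b h + b g)
    (hc : ∀ g h, c (g * h) = c g * ω h + c h) (g h : G) :
    ω' g * b g * c g + ω' h * b h * c h - ω' (g * h) * b (g * h) * c (g * h)
      = -(c g * b h + ω' (g * h) * b g * c h) := by
  rw [hb g h, hc g h, map_mul]
  linear_combination (-(ω' h * b h * c h + b h * c g)) * hinv g
    + (-(ω' g * b g * c g + ω' g * ω g * b h * c g)) * hinv h

/-- Local additivity: where `c` is the coboundary `β (ω − 1)`, the corrected diagonal cochain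
`φ = x + t β ω' b` is a homomorphism. -/
theorem soloInformed_torsionCorner_local_additive (ω ω' : G →* A)
    (hinv : ∀ g, ω g * ω' g = 1) (b c x : G → A) (β t : A)
    (hb : ∀ g h, b (g * h) = ω g * b h + b g)
    (hcβ : ∀ g, c g = β * (ω g - 1))
    (hx : ∀ g h, x (g * h) = x g + x h + t * ω' (g * h) * b g * c h) (g h : G) :
    (x (g * h) + t * β * ω' (g * h) * b (g * h))
      = (x g + t * β * ω' g * b g) + (x h + t * β * ω' h * b h) := by
  rw [hx g h, hb g h, hcβ h, map_mul]
  linear_combination (t * β * ω' h * b h) * hinv g + (t * β * ω' g * b g) * hinv h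

end cochains

section irreducibility

variable {K : Type*} [AddGroup K] {R : Type*} [CommRing R] [NoZeroDivisors R]

/-- An additive group is not the union of two proper subgroups: two additive maps to a domain
whose pointwise product vanishes cannot both be non-zero. -/
theorem soloInformed_addMonoidHom_mul_eq_zero (b c : K →+ R) (h : ∀ g, b g * c g = 0) :
    b = 0 ∨ c = 0 := by
  by_contra hne
  push Not at hne
  obtain ⟨hb, hc⟩ := hne
  obtain ⟨g₀, hg₀⟩ : ∃ g, b g ≠ 0 := by
    by_contra hall; push Not at hall; exact hb (AddMonoidHom.ext hall)
  obtain ⟨h₀, hh₀⟩ : ∃ g, c g ≠ 0 := by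
    by_contra hall; push Not at hall; exact hc (AddMonoidHom.ext hall)
  have hcg : c g₀ = 0 := by
    rcases mul_eq_zero.mp (h g₀) with h1 | h1
    · exact absurd h1 hg₀
    · exact h1
  have hbh : b h₀ = 0 := by
    rcases mul_eq_zero.mp (h h₀) with h1 | h1
    · exact h1
    · exact absurd h1 hh₀
  have := h (g₀ + h₀)
  rw [map_add, map_add, hcg, hbh, add_zero, zero_add] at this
  rcases mul_eq_zero.mp this with h1 | h1
  · exact hg₀ h1
  · exact hh₀ h1

/-- If the symmetrised form `c(g) b(h) + b(g) c(h)` vanishes identically and `2 ≠ 0`, then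
`b = 0` or `c = 0`. -/
theorem soloInformed_symm_form_eq_zero (h2 : (2 : R) ≠ 0) (b c : K →+ R)
    (h : ∀ g g', c g * b g' + b g * c g' = 0) : b = 0 ∨ c = 0 := by
  apply soloInformed_addMonoidHom_mul_eq_zero
  intro g
  have hg := h g g
  have : (2 : R) * (b g * c g) = 0 := by linear_combination hg
  rcases mul_eq_zero.mp this with h1 | h1
  · exact absurd h1 h2
  · exact h1

end irreducibility

end Summit.Langlands.Langlands.Theorems
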